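import Summits.Parity.GeneralizedHardyLittlewood.Theorems.LeeYangFibresCellParityLawP2Defs
import Summits.Parity.GeneralizedHardyLittlewood.Theorems.LeeYangFibresAbsoluteUpgradeDipDefs
import HarnessLib

/-!
# Crux `CellParityLawSaving` (stmt-Parity-18104) — ideator 1 sketch (round 1)

First-lemma statements for the two crux idea cards of `planner-cruxidea-stmt-Parity-18104-1-0`:

* card `sqrt-level-atom-ufree-kernel` (port of the section-annihilator line ALONG THE SCHEDULE with an
  exponent budget): `CellParityLawSavingAt`, `cellParityLawSaving_iff`, `SectionLevelPowAt`,
  `EffectiveWeightedP2LawUniform`, `PortReduction`;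
* card `rate-free-signed-residual` (port of the signed-switching line, `t = 2` engine):
  `roughCell'`, `cellSetTwo'`, `midResidualSched`, `DilatedMoebiusMidSaving`, `BVRoughCellsSched`,
  `ReductionTwoSaving`.

Nothing is asserted except the trivial `cellParityLawSaving_iff`; every other `def … : Prop` is a
statement (type of a future stub).  Vocabulary reused BY NAME from the tree: the dip line's `slowDegree`
(the schedule `U(N) = max 4 ⌊√(log log N)/2⌋`), the section-annihilator line's `sectionMass`,
`sectionDensity`, `KernelAdmissible`, `KernelRanges`, `weightedPairSum`, `primeMain`, `roughCellSum`,
`kernelErr` (Theorems/LeeYangFibresCellParityLaw{Defs,KernelDefs,P2Defs}.lean), the Literature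
`roughCellDensity`.  The `t = 2` objects `roughCell'`, `cellSetTwo'`, `midResidualSched` are adapted (with
`u := slowDegree N` and the schedule's window) from ideator 2's `Cruxes/CellParityLaw/Sketch-ideator2.lean`
of the fixed-degree sibling crux (attribution: planner-cruxidea-stmt-Parity-14109-2-0).
-/

noncomputable section

namespace Summit.Parity.GeneralizedHardyLittlewood.Cruxes.CellParityLawSaving.Ideator1

open scoped BigOperators Classical
open Finset Literature.NumberTheory.Sieve
open Summit.Parity.GeneralizedHardyLittlewood.Theses.LeeYangFibres
open Summit.Parity.GeneralizedHardyLittlewood.Cruxes.CellParityLaw.SectionAnnihilator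
open Summit.Parity.GeneralizedHardyLittlewood.Cruxes.AbsoluteUpgrade.DipMarginRateExchange (slowDegree)

/-! ## The crux sliced by the number of forms -/

/-- The crux `LeeYangFibres.CellParityLawSaving` at a fixed number `t` of forms (its body verbatim,
with `1 ≤ t` pulled out). -/
def CellParityLawSavingAt (t : ℕ) : Prop :=
  ∀ L : ℕ, ∃ δ : ℝ, 0 < δ ∧ ∃ N₀ : ℕ, ∀ N : ℕ, N₀ ≤ N →
    ∀ Ψ : Fin t → AffLinForm 1, IsNondegenerateSystem Ψ → affLinSize Ψ N ≤ L →
    ∀ K : Set (Fin 1 → ℝ), Convex ℝ K → K ⊆ realBox 1 N →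
    ∃ θ : Finset (Fin t) → ℝ, θ ∅ = 1 ∧ (∀ S, |θ S| ≤ 2) ∧
      ∀ j : Fin t → ℕ, (∀ i, 1 ≤ j i ∧ j i ≤ max 4 ⌊Real.sqrt (Real.log (Real.log N)) / 2⌋₊) →
        |((((latticeBox 1 N).filter (fun n => realPoint n ∈ K ∧ ∀ k,
              (N : ℝ) ^ ((1 : ℝ) / (max 4 ⌊Real.sqrt (Real.log (Real.log N)) / 2⌋₊ : ℕ)) <
                  (Nat.minFac ((Ψ k).eval n).toNat : ℝ) ∧
                ArithmeticFunction.cardFactors ((Ψ k).eval n).toNat = j k)).card : ℕ) : ℝ) -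
            (∑ S : Finset (Fin t), θ S * ∏ i ∈ S, (-1 : ℝ) ^ (j i + 1)) *
              (archFactor Ψ K * singularProduct Ψ *
                ∏ i, ((((Finset.Icc 1 N).filter (fun n =>
                  (N : ℝ) ^ ((1 : ℝ) / (max 4 ⌊Real.sqrt (Real.log (Real.log N)) / 2⌋₊ : ℕ)) <
                      (Nat.minFac n : ℝ) ∧
                    ArithmeticFunction.cardFactors n = j i)).card : ℕ) : ℝ) / N)| ≤
          (N : ℝ) / (Real.log N ^ t * Real.log N ^ δ)

/-- The crux is the conjunction of its `t`-slices (pure logic). -/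
theorem cellParityLawSaving_iff :
    CellParityLawSaving ↔ ∀ t : ℕ, 1 ≤ t → CellParityLawSavingAt t := by
  constructor
  · intro h t ht L
    exact h t L ht
  · intro h t L ht
    exact h t ht L

/-! ## Card `sqrt-level-atom-ufree-kernel` -/

/-- **The section atom along the schedule at a POWER-OF-LOG level deficit** (`SectionLevelPowAt t c`,
systems of `t + 1 ≥ 2` forms): Bombieri's `(A₂)` for every coordinate section sequence at roughness
`u = U(N)` (`slowDegree`), level `N^{1 - (log N)^{-c}}` — i.e. moduli `d ≤ N · exp(-(log N)^{1-c})`; at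
`c = 1/2`, level `N e^{-√(log N)}` — with saving `(log N)^{-A}` for every `A`, uniformly over systems of size
`≤ L`, convex `K ⊆ [-N,N]`, coordinates `i` and frozen cells `j' ∈ [1, U(N)]^t` of the other forms.  The
schedule version of the sibling line's `SectionLevelAt` (level `N^{1-(log log N)^{-B}}`); `c = 1/2` is the
only instance the port consumes.  Conjectural for `t + 1 ≥ 2` (an Elliott–Halberstam-type statement, one
class per modulus, beyond every `N^{1-ε}` but below the Friedlander–Granville–Hildebrand–Maier refuted zone
`N exp(-C (log log N)²/log log log N)`); for `t + 1 ≥ 3` the sections are multi-form cell sets. -/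
def SectionLevelPowAt (t : ℕ) (c : ℝ) : Prop :=
  ∀ (L A : ℕ), ∃ N₀ : ℕ, ∀ N : ℕ, N₀ ≤ N →
    ∀ Ψ : Fin (t + 1) → AffLinForm 1, IsNondegenerateSystem Ψ → affLinSize Ψ N ≤ L →
    ∀ K : Set (Fin 1 → ℝ), Convex ℝ K → K ⊆ realBox 1 N →
    ∀ i : Fin (t + 1), ∀ j' : Fin t → ℕ, (∀ k, 1 ≤ j' k ∧ j' k ≤ slowDegree N) →
      ∑ d ∈ (Finset.Icc 1 ⌊(N : ℝ) ^ (1 - 1 / Real.log N ^ c)⌋₊).filter Squarefree,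
          |(sectionMass Ψ K N (slowDegree N) i j' d : ℝ) -
              sectionDensity Ψ i d * sectionMass Ψ K N (slowDegree N) i j' 1|
        ≤ (N : ℝ) / Real.log N ^ A

/-- **The kernel with u-UNIFORM rate** (`EffectiveWeightedP2LawUniform`): the sibling line's research
stub `EffectiveWeightedP2Law` (Bombieri's weighted `P₂` law for the Buchstab test functions
`G_m(β) = I_m((1-β)/β) 1_{β > 1/u'}`, effective in the level deficit `η`) with the dependence on the
roughness `u` made EXPLICIT in the only shape the schedule `u = U(N) ≍ √(log log N)` can pay for: ONE
rate exponent `κ > 0` and ONE log-power `A₂` for all `u`, a constant inflating at most like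
`exp(C u log u)` (`= (log N)^{o(1)}` along the schedule), the deficit range `η ≤ η₀/u`, and a threshold
`x₀(u) ≤ exp(exp(4u²))` (`≤ N` exactly when `u ≤ U(N)`).  BUDGET (card §Why it bites): with
`η = (log N)^{-1/2}` the cell error is `(log N)^{o(1)} (η^κ + U/log N + …) · V B ≤ N/(log N)^{t + κ/3}`,
so the crux's `δ` can be taken `κ/3`; a constant `exp(c₀u²)` would instead need `κ > c₀/4`, and an
exponent `κ(u) → 0` or a log-power `A₂(u) → ∞` kills the port outright. -/
def EffectiveWeightedP2LawUniform : Prop :=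
  ∀ (A₁ L' : ℝ), ∃ (κ C η₀ : ℝ) (A₂ : ℕ), 0 < κ ∧ 0 ≤ C ∧ 0 < η₀ ∧
    ∀ u : ℕ, 2 ≤ u → ∃ x₀ : ℝ, x₀ ≤ Real.exp (Real.exp (4 * (u : ℝ) ^ 2)) ∧
      ∀ (𝒜 : SieveSequence) (x z η Λ w₀ R : ℝ), x₀ ≤ x →
        x ^ (1 / ((u : ℝ) + 1)) ≤ z → z ≤ x ^ (1 / 2 : ℝ) →
        KernelRanges x η Λ w₀ (η₀ / u) → KernelAdmissible A₁ L' 𝒜 x η Λ w₀ R →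
        ∀ j : ℕ, 1 ≤ j →
          |weightedPairSum 𝒜 x z j -
              roughCellDensity (j + 1) (Real.log x / Real.log z) *
                (2 * primeMain 𝒜 x z - roughCellSum 𝒜 x z 1)|
            ≤ kernelErr (C * Real.exp (C * u * Real.log u)) κ A₂ 𝒜 x z η Λ R

/-- **The port's reduction** (type of the composition a crux-plan seat would have to kernel-check):
the power-of-log atoms for every number of forms at the single deficit exponent `c = 1/2`, and the
u-uniform kernel, imply the crux — via the sibling line's landed glue re-run with `u := slowDegree N`
(section sequences in Bombieri's normalisation, covering, Walsh inversion `stub_walshStep`-shape,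
`KernelInduction`, `PrimeUpperBound`, Alladi along the schedule `AnatomyAlong`). A statement, not a proof. -/
def PortReduction : Prop :=
  (∀ t : ℕ, SectionLevelPowAt t (1 / 2)) → EffectiveWeightedP2LawUniform → CellParityLawSaving

/-! ## Card `rate-free-signed-residual` (the `t = 2` engine) -/

/-- `m` lies in the rough `Ω`-cell `j` at roughness `N^{1/u}` (the crux's cell predicate on one value). -/
def roughCell' (N u j m : ℕ) : Prop :=
  (N : ℝ) ^ ((1 : ℝ) / u) < (Nat.minFac m : ℝ) ∧ ArithmeticFunction.cardFactors m = j

/-- The conditioning set of a pair system: lattice points of `K ∩ [-N,N]` whose OTHER form `ψ_{1-i}`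
lies in the rough cell `j` (roughness `N^{1/u}`). -/
def cellSetTwo' (Ψ : Fin 2 → AffLinForm 1) (K : Set (Fin 1 → ℝ)) (N u : ℕ) (i : Fin 2) (j : ℕ) :
    Finset (Fin 1 → ℤ) :=
  (latticeBox 1 N).filter fun n => realPoint n ∈ K ∧ roughCell' N u j ((Ψ i.rev).eval n).toNat

/-- **The mid-range signed residual along the schedule** (`midResidualSched Ψ K N k i j ρ c`): Möbius along
the DILATED copies `ψ_i/e` of the sectioned form tested against one rough cell of the other form, with the
`(log e)^k` weight of the Friedlander–Iwaniec switch, over dilations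
`e ∈ [exp((log N)^c), N^{1/2+ρ}]` and cofactors `ψ_i(n)/e > N^{1/2-ρ}` (the part beyond the
Bombieri–Vinogradov truncation, kept SIGNED); roughness `u = slowDegree N`. -/
def midResidualSched (Ψ : Fin 2 → AffLinForm 1) (K : Set (Fin 1 → ℝ)) (N k : ℕ) (i : Fin 2)
    (j : ℕ) (ρ c : ℝ) : ℝ :=
  ∑ e ∈ Icc ⌈Real.exp (Real.log N ^ c)⌉₊ ⌊(N : ℝ) ^ ((1 : ℝ) / 2 + ρ)⌋₊,
    Real.log e ^ k *
      |∑ n ∈ (cellSetTwo' Ψ K N (slowDegree N) i j).filter (fun n =>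
          (e : ℤ) ∣ (Ψ i).eval n ∧
            (N : ℝ) ^ ((1 : ℝ) / 2 - ρ) < ((((Ψ i).eval n).toNat / e : ℕ) : ℝ)),
        (ArithmeticFunction.moebius (((Ψ i).eval n).toNat / e) : ℝ)|

/-- **The residual atom with a log-power saving** (`DilatedMoebiusMidSaving`): for every size `L`,
degree `k ≥ 3`, window exponent `c < (k-1)/(k+1)` and truncation `ρ ∈ (0, 1/4)` there are `δ' > 0` and
`N₀` with `midResidualSched ≤ N (log N)^{k-2} / (log N)^{2 + δ'}`... — stated as the RELATIVE saving the
finite-level identity consumes: the residual is `(log N)^{-(2+δ')}` below its trivial size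
`≍ N (log N)^k / (k 2^k)`, i.e. `≤ N (log N)^{k-2-δ'}`, for every pair system of size `≤ L`, convex
`K ⊆ [-N,N]`, coordinate `i` and every conditioning cell `j ≤ U(N)`.  Parity-SENSITIVE (Möbius along
shifted almost-prime sets, dilation-averaged, main-term-free) — the whole conjectural input of the
`t = 2` engine; it must be carried Siegel-aware at crux-plan time (`μ - μ_exc`), as the sibling card
records. -/
def DilatedMoebiusMidSaving : Prop :=
  ∀ (L k : ℕ) (c ρ : ℝ), 3 ≤ k → 0 < c → c < ((k : ℝ) - 1) / (k + 1) → 0 < ρ → ρ < 1 / 4 →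
    ∃ δ' : ℝ, 0 < δ' ∧ ∃ N₀ : ℕ, ∀ N : ℕ, N₀ ≤ N →
      ∀ Ψ : Fin 2 → AffLinForm 1, IsNondegenerateSystem Ψ → affLinSize Ψ N ≤ L →
        ∀ K : Set (Fin 1 → ℝ), Convex ℝ K → K ⊆ realBox 1 N →
          ∀ i : Fin 2, ∀ j : ℕ, 1 ≤ j → j ≤ slowDegree N →
            midResidualSched Ψ K N k i j ρ c ≤ (N : ℝ) * Real.log N ^ ((k : ℝ) - 2 - δ')

/-- **Bombieri–Vinogradov for single-form rough cells along the schedule** (`BVRoughCellsSched`;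
provable now: Siegel–Walfisz for products of `j ≤ U(N)` primes `> N^{1/U(N)}` + the bilinear large sieve,
`BombieriFriedlanderIwaniecTheorem0b_holds`): level `N^{1/2-ρ}`, every log-power saving, moduli coprime
to the form's coefficient (ideator-2's statement with triager-1's F1 repair, `u := slowDegree N`). -/
def BVRoughCellsSched : Prop :=
  ∀ (L : ℕ), ∀ ρ : ℝ, 0 < ρ → ∀ A : ℝ, 0 < A →
    ∃ N₀ : ℕ, ∀ N : ℕ, N₀ ≤ N →
      ∀ ψ : AffLinForm 1, ψ.coeff ≠ 0 → affLinSize ![ψ] N ≤ L → ∀ j : ℕ, 1 ≤ j → j ≤ slowDegree N →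
        ∀ (a : ℕ → ℤ) (x : ℕ → ℤ), (∀ q, -(N : ℤ) ≤ x q ∧ x q ≤ N) →
          ∑ q ∈ (Icc 1 ⌊(N : ℝ) ^ ((1 : ℝ) / 2 - ρ)⌋₊).filter
              (fun q => Nat.Coprime q ((ψ.coeff 0).natAbs)),
            (if IsCoprime (a q) (q : ℤ) then
              |((((Icc (-(N : ℤ)) (x q)).filter (fun n =>
                    roughCell' N (slowDegree N) j (ψ.eval ![n]).toNat ∧ (q : ℤ) ∣ ψ.eval ![n] - a q)).card : ℕ) : ℝ)
                - ((((Icc (-(N : ℤ)) (x q)).filter (fun n =>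
                    roughCell' N (slowDegree N) j (ψ.eval ![n]).toNat ∧
                      IsCoprime (ψ.eval ![n]) (q : ℤ))).card : ℕ) : ℝ) / Nat.totient q|
             else 0)
            ≤ N / Real.log N ^ A

/-- **The `t = 2` reduction of the rate-free engine** (type of the composition): Bombieri–Vinogradov for
rough cells along the schedule and the residual atom with a log-power saving give the pair slice of the
crux. -/
def ReductionTwoSaving : Prop :=
  BVRoughCellsSched → DilatedMoebiusMidSaving → CellParityLawSavingAt 2

end Summit.Parity.GeneralizedHardyLittlewood.Cruxes.CellParityLawSaving.Ideator1

end
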